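import Summits.AnomalousDissipation.AnomalousDissipation.Theorems.MomentLadder.Negative.Clauses
import Literature.Analysis.FunctionSpaces.TorusEnstrophyTrilinear
import Literature.Analysis.FunctionSpaces.TorusTruncationH1
import Literature.Analysis.FluidPDE.ZerothLaw

/-!
# The enstrophy test field: stub `stub_enstrophyTestField` of line `Sketch`
# (crux `MomentParity.MomentLadder`, stmt-AnomalousDissipation-11463)

For every level `N` and every real polynomial `p` we exhibit an admissible polynomial cylindrical
test `(g, P)` of the crux whose differential is `∇P(u) = 2 p'(Z(P_N u)) · (−Δ P_N u)` for every
`u ∈ H`, `Z = ‖∇·‖₂²` (spectral, `Torus.eGradNormSq`): `g` is the Galerkin frame of level `N`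
(`CubicParityLoud.Negative.frameG N`, the real Stokes eigenfields `cos/sin(2πk·x) perpVec k j`,
`0 < |k| ≤ N`, admissible by `CubicParityLoud.Negative.isBandTest_frameG`) and `P = p ∘ Q` with the
ENSTROPHY POLYNOMIAL `Q = Σᵢ 4π²|kᵢ|² Xᵢ²`.  Ingredients: the chain rule for the derivation
`MvPolynomial.pderiv i` through `Polynomial.aeval` (`Derivation.map_aeval`), the enstrophy-Parseval
identity of the frame `Q((u,gᵢ)ᵢ) = Z(P_N u)` (per frequency `Σⱼ Σ_c (u,e_{kjc})² = ‖û(k)‖²`,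
`Torus.sum_sum_sq_re_inner_frameVec`), and the field identity
`Σᵢ 4π²|kᵢ|² (u,gᵢ) gᵢ = −Δ P_N u` (per frequency `Σⱼ Σ_c (u,e_{kjc}) e_{kjc} x = Re (e_k(x) û(k))`,
`Torus.sum_sum_re_inner_frameVec_smul`, and `Torus.laplacian_realTrigPoly`).  Pure bookkeeping.
-/

set_option linter.dupNamespace false

noncomputable section

namespace Summit.AnomalousDissipation.AnomalousDissipation.Theorems.MomentLadder

open MeasureTheory Filter Topology Set
open scoped ENNReal NNReal InnerProductSpace RealInnerProductSpace Polynomial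
open Literature.Analysis.FunctionSpaces Literature.Analysis.FluidPDE
open Summit.AnomalousDissipation.AnomalousDissipation.Theses.MomentParity
open Summit.AnomalousDissipation.AnomalousDissipation.Theorems.QuarticGate.Negative
open Summit.AnomalousDissipation.AnomalousDissipation.Theorems.MomentLadder.Negative

section EnstrophyTestField

open UnitAddTorus

/-- **Chain rule for the enstrophy-type test polynomials**: for `Q = Σⱼ wⱼ Xⱼ²` and a real
polynomial `p`, `∂ᵢ (p ∘ Q)(v) = p'(Q(v)) · 2 wᵢ vᵢ`. -/
theorem eval_pderiv_aeval_weightedSq {n : ℕ} (w v : Fin n → ℝ) (p : ℝ[X]) (i : Fin n) :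
    MvPolynomial.eval v (MvPolynomial.pderiv i
      (Polynomial.aeval (∑ j : Fin n, MvPolynomial.C (w j) * MvPolynomial.X j ^ 2) p)) =
      (Polynomial.derivative p).eval (∑ j, w j * v j ^ 2) * (2 * w i * v i) := by
  classical
  set Q : MvPolynomial (Fin n) ℝ := ∑ j : Fin n, MvPolynomial.C (w j) * MvPolynomial.X j ^ 2 with hQ
  have hevalQ : MvPolynomial.eval v Q = ∑ j, w j * v j ^ 2 := by
    simp [hQ, map_sum]
  have hcomp : MvPolynomial.eval v (Polynomial.aeval Q (Polynomial.derivative p)) =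
      (Polynomial.derivative p).eval (MvPolynomial.eval v Q) := by
    have h := Polynomial.aeval_algHom_apply (MvPolynomial.aeval v) Q (Polynomial.derivative p)
    simp only [MvPolynomial.aeval_eq_eval, Polynomial.coe_aeval_eq_eval] at h
    exact h.symm
  have hpd : MvPolynomial.eval v (MvPolynomial.pderiv i Q) = 2 * w i * v i := by
    simp [hQ, map_sum, Derivation.leibniz_pow, MvPolynomial.pderiv_X, Pi.single_apply,
      Finset.sum_ite_eq', mul_comm, mul_left_comm, mul_assoc]
  rw [Derivation.map_aeval, smul_eq_mul, map_mul, hcomp, hevalQ, hpd]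

/-- Sums over the `Fin`-indexing of the Galerkin frame of level `N` are sums over frequencies
`0 < |k| ≤ N`, directions `j` and phases `c`. -/
theorem sum_frameIdx_eq {M : Type*} [AddCommMonoid M] (N : ℕ)
    (G : (Fin 3 → ℤ) → Fin 3 → Bool → M) :
    ∑ i : Fin (Torus.galerkinTest (d := Fin 3) N one_pos).m,
        G (((Fintype.equivFin (Torus.FrameIdx (Fin 3) N)).symm i).1 : Fin 3 → ℤ)
          ((Fintype.equivFin (Torus.FrameIdx (Fin 3) N)).symm i).2.1
          ((Fintype.equivFin (Torus.FrameIdx (Fin 3) N)).symm i).2.2 =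
      ∑ k ∈ Torus.freqBall₀ N, ∑ j : Fin 3, ∑ c : Bool, G k j c := by
  have h1 : ∑ i : Fin (Torus.galerkinTest (d := Fin 3) N one_pos).m,
        G (((Fintype.equivFin (Torus.FrameIdx (Fin 3) N)).symm i).1 : Fin 3 → ℤ)
          ((Fintype.equivFin (Torus.FrameIdx (Fin 3) N)).symm i).2.1
          ((Fintype.equivFin (Torus.FrameIdx (Fin 3) N)).symm i).2.2 =
      ∑ q : Torus.FrameIdx (Fin 3) N, G (q.1 : Fin 3 → ℤ) q.2.1 q.2.2 :=
    Fintype.sum_equiv (Fintype.equivFin (Torus.FrameIdx (Fin 3) N)).symm _ _ fun _ => rfl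
  rw [h1, Fintype.sum_prod_type, ← Finset.sum_coe_sort (Torus.freqBall₀ N)]
  refine Finset.sum_congr rfl fun k _ => ?_
  rw [Fintype.sum_prod_type]

/-- **Enstrophy-Parseval identity of the frame**: for `u ∈ H`,
`Σ_{0<|k|≤N} Σⱼ Σ_c 4π²|k|² (u, e_{kjc})² = ‖∇ P_N u‖₂²`. -/
theorem sum_frame_weighted_sq_eq_toReal_eGradNormSq (N : ℕ) (u : Torus.energySpace (Fin 3)) :
    ∑ k ∈ Torus.freqBall₀ N, ∑ j : Fin 3, ∑ c : Bool,
        4 * Real.pi ^ 2 * Torus.freqNormSq k *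
          (∫ y, ⟪(u.1 : UnitAddTorus (Fin 3) → EuclideanSpace ℝ (Fin 3)) y,
            Torus.frameField k j c y⟫_ℝ) ^ 2 =
      (Torus.eGradNormSq (Torus.fourierTruncate N
        (u.1 : UnitAddTorus (Fin 3) → EuclideanSpace ℝ (Fin 3)))).toReal := by
  have hmem : MemLp (u.1 : UnitAddTorus (Fin 3) → EuclideanSpace ℝ (Fin 3)) 2 volume := Lp.memLp u.1
  have hint : Integrable (u.1 : UnitAddTorus (Fin 3) → EuclideanSpace ℝ (Fin 3)) volume :=
    hmem.integrable one_le_two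
  have hdiv := Torus.isWeaklyDivFree_of_mem_energySpace u.2
  have key : ∀ k ∈ Torus.freqBall₀ N, ∑ j : Fin 3, ∑ c : Bool,
      4 * Real.pi ^ 2 * Torus.freqNormSq k *
        (∫ y, ⟪(u.1 : UnitAddTorus (Fin 3) → EuclideanSpace ℝ (Fin 3)) y,
          Torus.frameField k j c y⟫_ℝ) ^ 2 =
      4 * Real.pi ^ 2 * (Torus.freqNormSq k *
        ‖mFourierCoeff (EuclideanSpace.complexify ∘
          (u.1 : UnitAddTorus (Fin 3) → EuclideanSpace ℝ (Fin 3))) k‖ ^ 2) := by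
    intro k _
    simp_rw [← Finset.mul_sum, Torus.frameField, Torus.integral_inner_realTrigPoly_singleton hint]
    rw [Torus.sum_sum_sq_re_inner_frameVec (hdiv.sum_mul_mFourierCoeff_eq_zero hmem k), mul_assoc]
  rw [Finset.sum_congr rfl key, ← Finset.mul_sum, Torus.freqBall₀,
    Finset.sum_erase _ (by rw [Torus.freqNormSq_zero, zero_mul]), Torus.fourierTruncate_eq,
    Torus.toReal_eGradNormSq_realTrigPoly Torus.neg_mem_freqBall_of_mem
      (Torus.isConjSymm_mFourierCoeff hint)]

/-- **The frame diagonalises the Stokes operator**: for `u ∈ H` and every point `x`,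
`Σ_{0<|k|≤N} Σⱼ Σ_c 4π²|k|² (u, e_{kjc}) e_{kjc}(x) = −Δ (P_N u)(x)`. -/
theorem sum_frame_weighted_smul_eq_neg_laplacian (N : ℕ) (u : Torus.energySpace (Fin 3))
    (x : UnitAddTorus (Fin 3)) :
    ∑ k ∈ Torus.freqBall₀ N, ∑ j : Fin 3, ∑ c : Bool,
        (4 * Real.pi ^ 2 * Torus.freqNormSq k *
          ∫ y, ⟪(u.1 : UnitAddTorus (Fin 3) → EuclideanSpace ℝ (Fin 3)) y,
            Torus.frameField k j c y⟫_ℝ) • Torus.frameField k j c x =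
      -(Torus.laplacian (Torus.fourierTruncate N
        (u.1 : UnitAddTorus (Fin 3) → EuclideanSpace ℝ (Fin 3))) x) := by
  have hmem : MemLp (u.1 : UnitAddTorus (Fin 3) → EuclideanSpace ℝ (Fin 3)) 2 volume := Lp.memLp u.1
  have hint : Integrable (u.1 : UnitAddTorus (Fin 3) → EuclideanSpace ℝ (Fin 3)) volume :=
    hmem.integrable one_le_two
  have hdiv := Torus.isWeaklyDivFree_of_mem_energySpace u.2
  have key : ∀ k ∈ Torus.freqBall₀ N, ∑ j : Fin 3, ∑ c : Bool,
      (4 * Real.pi ^ 2 * Torus.freqNormSq k *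
        ∫ y, ⟪(u.1 : UnitAddTorus (Fin 3) → EuclideanSpace ℝ (Fin 3)) y,
          Torus.frameField k j c y⟫_ℝ) • Torus.frameField k j c x =
      (4 * Real.pi ^ 2 * Torus.freqNormSq k) • EuclideanSpace.realPart (mFourier k x •
        mFourierCoeff (EuclideanSpace.complexify ∘
          (u.1 : UnitAddTorus (Fin 3) → EuclideanSpace ℝ (Fin 3))) k) := by
    intro k _
    simp_rw [mul_smul (4 * Real.pi ^ 2 * Torus.freqNormSq k), ← Finset.smul_sum]
    congr 1
    simp_rw [Torus.frameField, Torus.integral_inner_realTrigPoly_singleton hint,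
      Torus.realTrigPoly_singleton_apply, Torus.smul_realPart_mFourier_smul, ← map_sum,
      ← Finset.smul_sum]
    rw [Torus.sum_sum_re_inner_frameVec_smul (hdiv.sum_mul_mFourierCoeff_eq_zero hmem k)]
  rw [Finset.sum_congr rfl key, Torus.freqBall₀,
    Finset.sum_erase _ (by rw [Torus.freqNormSq_zero, mul_zero, zero_smul]),
    Torus.fourierTruncate_eq, Torus.laplacian_realTrigPoly, Torus.realTrigPoly_apply_eq_sum,
    ← Finset.sum_neg_distrib]
  refine Finset.sum_congr rfl fun k _ => ?_
  rw [smul_neg, map_neg, neg_neg, Torus.smul_realPart_mFourier_smul]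

/-- STUB A2a. **The enstrophy test field.** For every level `N` and every real polynomial `p`
there is an admissible polynomial cylindrical test `(g, P)` of the crux — `g` the Galerkin frame of
level `N`, `P = p ∘ Q` with the enstrophy polynomial `Q = Σᵢ 4π²|kᵢ|² Xᵢ²` — whose differential is
`∇P(u) = 2 p'(Z(P_N u)) · (−Δ P_N u)` for every `u ∈ H`. -/
theorem stub_enstrophyTestField :
    ∀ (N : ℕ) (p : ℝ[X]), ∃ (m : ℕ) (g : Fin m → UnitAddTorus (Fin 3) → EuclideanSpace ℝ (Fin 3))
      (P : MvPolynomial (Fin m) ℝ), (∀ i, IsBandTest N (g i)) ∧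
      ∀ u : Torus.energySpace (Fin 3), polyGrad g P u = fun x =>
        (2 * (Polynomial.derivative p).eval
          (Torus.eGradNormSq (Torus.fourierTruncate N
            (u.1 : UnitAddTorus (Fin 3) → EuclideanSpace ℝ (Fin 3)))).toReal) •
          (-(Torus.laplacian (Torus.fourierTruncate N
            (u.1 : UnitAddTorus (Fin 3) → EuclideanSpace ℝ (Fin 3))) x)) := by
  intro N p
  -- the Stokes eigenvalue `4π²|kᵢ|²` of the `i`-th frame field
  set w : Fin (Torus.galerkinTest (d := Fin 3) N one_pos).m → ℝ := fun i =>
    4 * Real.pi ^ 2 * Torus.freqNormSq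
      (((Fintype.equivFin (Torus.FrameIdx (Fin 3) N)).symm i).1 : Fin 3 → ℤ) with hw
  refine ⟨(Torus.galerkinTest (d := Fin 3) N one_pos).m, CubicParityLoud.Negative.frameG N,
    Polynomial.aeval (∑ j, MvPolynomial.C (w j) * MvPolynomial.X j ^ 2) p,
    fun i => CubicParityLoud.Negative.isBandTest_frameG N i, fun u => ?_⟩
  set Z : ℝ := (Torus.eGradNormSq (Torus.fourierTruncate N
    (u.1 : UnitAddTorus (Fin 3) → EuclideanSpace ℝ (Fin 3)))).toReal with hZ
  -- enstrophy-Parseval: `Q((u, gᵢ)ᵢ) = Z(P_N u)`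
  have hQ : ∑ j, w j * (Torus.pairing u.1 (CubicParityLoud.Negative.frameG N j)) ^ 2 = Z := by
    rw [hZ, ← sum_frame_weighted_sq_eq_toReal_eGradNormSq N u]
    exact sum_frameIdx_eq N (fun k j c => 4 * Real.pi ^ 2 * Torus.freqNormSq k *
      (∫ y, ⟪(u.1 : UnitAddTorus (Fin 3) → EuclideanSpace ℝ (Fin 3)) y,
        Torus.frameField k j c y⟫_ℝ) ^ 2)
  funext x
  -- the frame diagonalises the Stokes operator: `Σᵢ wᵢ (u, gᵢ) gᵢ x = −Δ(P_N u) x`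
  have hA : ∑ i, (w i * Torus.pairing u.1 (CubicParityLoud.Negative.frameG N i)) •
      CubicParityLoud.Negative.frameG N i x =
      -(Torus.laplacian (Torus.fourierTruncate N
        (u.1 : UnitAddTorus (Fin 3) → EuclideanSpace ℝ (Fin 3))) x) := by
    rw [← sum_frame_weighted_smul_eq_neg_laplacian N u x]
    exact sum_frameIdx_eq N (fun k j c => (4 * Real.pi ^ 2 * Torus.freqNormSq k *
      ∫ y, ⟪(u.1 : UnitAddTorus (Fin 3) → EuclideanSpace ℝ (Fin 3)) y,
        Torus.frameField k j c y⟫_ℝ) • Torus.frameField k j c x)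
  simp only [polyGrad, eval_pderiv_aeval_weightedSq]
  rw [hQ, ← hA, Finset.smul_sum]
  refine Finset.sum_congr rfl fun i _ => ?_
  rw [smul_smul]
  congr 1
  ring

end EnstrophyTestField

end Summit.AnomalousDissipation.AnomalousDissipation.Theorems.MomentLadder

end
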